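import Summits.QuantumFields.YangMills.Theorems.AllWindowsColdBoxBoxHighLineEdgeChartWick
import Mathlib.Algebra.MvPolynomial.Degrees

/-!
# T-S5 Wick layer, part 3 — integrability and linearity of monomial moments in the edge chart, and the observables of STEP 2 as
# polynomials of bounded total degree (the interface to w5 g22's hypercontractivity brick «T-S5.10-H»)

Planner ym-idea-2 g18's `STUB-PLAN-S5-STEP2.md` §3–§4 (T-S5.10 decorrelation, T-S5.12a cubic variance; owner LEAD g77) compute Gaussian moments of the chart
observables `c_p^{(2)}(a) = Σ_c (landauCoeff H p ⬝ᵥ a^c)²` and of cubic vertices `Σ_x coef_x · a_{ℓ₁(x)} a_{ℓ₂(x)} a_{ℓ₃(x)}` under `exp(−β Σ_c a^c·L·a^c) da`.  This file supplies: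

* §1 `integrable_prodCoord_mul_exp_colourForm` — every monomial of colour components times the Gaussian weight is integrable (any finite leg family);
* §2 `integral_prodCoord_fintype_eq_pairingSum` — Wick's theorem for a leg family indexed by ANY finite type of even cardinality (reindexing along
  `κ ≃ Fin 2k`), and `integral_sumProd_mul_sumProd` — bilinearity: `∫ (Σ_k c_k M_k)(Σ_l d_l N_l) e^{−βQ} = Σ_k Σ_l c_k d_l ∫ M_k N_l e^{−βQ}` with the
  concatenated monomial `M_k N_l = ∏_{Fin m ⊕ Fin m'} …`;
* §3 (for «T-S5.10-H», w5 g22: hypercontractivity is stated for `MvPolynomial.eval` of bounded `totalDegree`) the STEP-2 observables ARE such evaluations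
  in the flat variables `♭a`: `exists_mvPolynomial_colourSumSq` (degree ≤ 2: `c_u`), `exists_mvPolynomial_colourSumSq_sub_const` (centred `c̃_u`),
  `exists_mvPolynomial_sum_prodCoord` (degree ≤ m: any finite linear combination of `m`-fold products of colour components, e.g. `V₃` with `m = 3`).

Tree (✓EdgeChartWick) + Mathlib; no definitions (existence statements only).  HONEST LABEL: bookkeeping for STEP 2 of the XL stub S5 of a critic-PASSed DRAFT line;
T-S5.7/10/12/13, S5, U5, ⟨24004⟩ ⟨24335⟩ ⟨24336⟩ remain OPEN; route AllWindowsColdBox is DRAFT; no rung is proved; the Yang–Mills mass gap is NOT proved by this file.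
Seat ym-line-sfw-p2 g77 (LEAD, cell ym-idea-1; Wick layer T-S5.10/11/12a).
-/

set_option autoImplicit false

noncomputable section

open MeasureTheory Matrix Finset
open scoped Kronecker
open Literature.Probability.LatticeModels (pairingSum pairingSum_congr_of_eq)

namespace Summit.QuantumFields.YangMills.Theorems.AllWindowsColdBoxBoxHighLine

namespace EdgeChartGaussian

open LaplaceSandwich (flatten flatten_apply volume_preserving_flatten)
open GaussianChartWick

variable {I : Type} [Fintype I] [DecidableEq I]

/-! ## §1 Integrability of monomial moments -/

/-- Every monomial of colour components (any finite leg family) times `exp(−β Σ_c a^c·L·a^c)` is integrable, `L` positive definite, `β > 0`. -/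
theorem integrable_prodCoord_mul_exp_colourForm (L : Matrix I I ℝ) (hL : L.PosDef) {β : ℝ} (hβ : 0 < β)
    {κ : Type*} (s : Finset κ) (leg : κ → I × Fin 3) :
    Integrable (fun a : I → EuclideanSpace ℝ (Fin 3) => (∏ i ∈ s, a (leg i).1 (leg i).2) *
      Real.exp (-(β * ∑ c : Fin 3, (fun e => a e c) ⬝ᵥ (L *ᵥ fun e => a e c)))) := by
  have h := integrable_prod_dotProduct_mul_exp_quadForm' _ (posDef_kronecker_one (o := Fin 3) L hL) hβ s
    (fun i => Pi.single (leg i) (1 : ℝ))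
  rw [← (volume_preserving_flatten I).integrable_comp_emb (flatten I).measurableEmbedding] at h
  refine h.congr (Filter.Eventually.of_forall fun a => ?_)
  simp only [Function.comp_apply, single_one_dotProduct, ← colourForm_eq_flat]
  rfl

/-- The `Fin m`-indexed case. -/
theorem integrable_prodCoord_mul_exp_colourForm' (L : Matrix I I ℝ) (hL : L.PosDef) {β : ℝ} (hβ : 0 < β)
    {m : ℕ} (leg : Fin m → I × Fin 3) :
    Integrable (fun a : I → EuclideanSpace ℝ (Fin 3) => (∏ i, a (leg i).1 (leg i).2) *
      Real.exp (-(β * ∑ c : Fin 3, (fun e => a e c) ⬝ᵥ (L *ᵥ fun e => a e c)))) :=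
  integrable_prodCoord_mul_exp_colourForm L hL hβ Finset.univ leg

/-! ## §2 Reindexing and bilinearity -/

/-- Wick's theorem for a leg family indexed by any finite type `κ` with `κ ≃ Fin 2k`. -/
theorem integral_prodCoord_fintype_eq_pairingSum (L : Matrix I I ℝ) (hL : L.PosDef) {β : ℝ} (hβ : 0 < β)
    {κ : Type*} [Fintype κ] {k : ℕ} (e : κ ≃ Fin (2 * k)) (leg : κ → I × Fin 3) :
    ∫ a : I → EuclideanSpace ℝ (Fin 3), (∏ i, a (leg i).1 (leg i).2) *
        Real.exp (-(β * ∑ c : Fin 3, (fun e => a e c) ⬝ᵥ (L *ᵥ fun e => a e c))) =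
      Real.sqrt (Real.pi / β) ^ Fintype.card (I × Fin 3) / Real.sqrt (L ⊗ₖ (1 : Matrix (Fin 3) (Fin 3) ℝ)).det *
        pairingSum (fun p q : I × Fin 3 => (2 * β)⁻¹ * if p.2 = q.2 then L⁻¹ p.1 q.1 else 0) k (leg ∘ e.symm) := by
  rw [← integral_prodCoord_mul_exp_colourForm_eq_pairingSum L hL hβ k (leg ∘ e.symm)]
  refine integral_congr_ae (Filter.Eventually.of_forall fun a => ?_)
  simp only [Function.comp_apply]
  rw [← Fintype.prod_equiv e.symm (fun j => a (leg (e.symm j)).1 (leg (e.symm j)).2) (fun i => a (leg i).1 (leg i).2) fun _ => rfl]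

/-- Parity for a leg family indexed by any finite type of odd cardinality. -/
theorem integral_prodCoord_fintype_odd (L : Matrix I I ℝ) (hL : L.PosDef) {β : ℝ} (hβ : 0 < β)
    {κ : Type*} [Fintype κ] {k : ℕ} (e : κ ≃ Fin (2 * k + 1)) (leg : κ → I × Fin 3) :
    ∫ a : I → EuclideanSpace ℝ (Fin 3), (∏ i, a (leg i).1 (leg i).2) *
        Real.exp (-(β * ∑ c : Fin 3, (fun e => a e c) ⬝ᵥ (L *ᵥ fun e => a e c))) = 0 := by
  rw [← integral_prodCoord_mul_exp_colourForm_odd L hL hβ k (leg ∘ e.symm)]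
  refine integral_congr_ae (Filter.Eventually.of_forall fun a => ?_)
  simp only [Function.comp_apply]
  rw [← Fintype.prod_equiv e.symm (fun j => a (leg (e.symm j)).1 (leg (e.symm j)).2) (fun i => a (leg i).1 (leg i).2) fun _ => rfl]

omit [Fintype I] [DecidableEq I] in
/-- The product of two monomials is the monomial of the concatenated leg family (`Fin m ⊕ Fin m'`). -/
theorem prodCoord_mul_prodCoord {m m' : ℕ} (leg : Fin m → I × Fin 3) (leg' : Fin m' → I × Fin 3) (a : I → EuclideanSpace ℝ (Fin 3)) :
    (∏ i, a (leg i).1 (leg i).2) * (∏ j, a (leg' j).1 (leg' j).2) = ∏ s : Fin m ⊕ Fin m', a ((Sum.elim leg leg') s).1 ((Sum.elim leg leg') s).2 := by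
  rw [Fintype.prod_sum_type]
  simp only [Sum.elim_inl, Sum.elim_inr]

/-- **Bilinearity of Gaussian moments**: for finite linear combinations of monomials `M_k = ∏_i a_{leg k i}`, `N_l = ∏_j a_{leg' l j}`,
`∫ (Σ_k c_k M_k)(Σ_l d_l N_l) e^{−βQ} = Σ_k Σ_l c_k d_l · ∫ (∏_{Fin m ⊕ Fin m'} a_{(leg k, leg' l)}) e^{−βQ}`. -/
theorem integral_sumProd_mul_sumProd (L : Matrix I I ℝ) (hL : L.PosDef) {β : ℝ} (hβ : 0 < β)
    {κ κ' : Type*} (A : Finset κ) (B : Finset κ') (cA : κ → ℝ) (cB : κ' → ℝ) {m m' : ℕ}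
    (leg : κ → Fin m → I × Fin 3) (leg' : κ' → Fin m' → I × Fin 3) :
    ∫ a : I → EuclideanSpace ℝ (Fin 3), (∑ k ∈ A, cA k * ∏ i, a (leg k i).1 (leg k i).2) * (∑ l ∈ B, cB l * ∏ j, a (leg' l j).1 (leg' l j).2) *
        Real.exp (-(β * ∑ c : Fin 3, (fun e => a e c) ⬝ᵥ (L *ᵥ fun e => a e c))) =
      ∑ k ∈ A, ∑ l ∈ B, cA k * cB l *
        ∫ a : I → EuclideanSpace ℝ (Fin 3), (∏ s : Fin m ⊕ Fin m', a ((Sum.elim (leg k) (leg' l)) s).1 ((Sum.elim (leg k) (leg' l)) s).2) *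
          Real.exp (-(β * ∑ c : Fin 3, (fun e => a e c) ⬝ᵥ (L *ᵥ fun e => a e c))) := by
  have hexp : ∀ a : I → EuclideanSpace ℝ (Fin 3),
      (∑ k ∈ A, cA k * ∏ i, a (leg k i).1 (leg k i).2) * (∑ l ∈ B, cB l * ∏ j, a (leg' l j).1 (leg' l j).2) *
          Real.exp (-(β * ∑ c : Fin 3, (fun e => a e c) ⬝ᵥ (L *ᵥ fun e => a e c))) =
        ∑ k ∈ A, ∑ l ∈ B, cA k * cB l *
          ((∏ s : Fin m ⊕ Fin m', a ((Sum.elim (leg k) (leg' l)) s).1 ((Sum.elim (leg k) (leg' l)) s).2) *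
            Real.exp (-(β * ∑ c : Fin 3, (fun e => a e c) ⬝ᵥ (L *ᵥ fun e => a e c)))) := by
    intro a
    rw [Finset.sum_mul_sum, Finset.sum_mul]
    refine Finset.sum_congr rfl fun k _ => ?_
    rw [Finset.sum_mul]
    refine Finset.sum_congr rfl fun l _ => ?_
    rw [← prodCoord_mul_prodCoord]
    ring
  simp_rw [hexp]
  rw [integral_finsetSum _ fun k _ => integrable_finsetSum _ fun l _ =>
    (integrable_prodCoord_mul_exp_colourForm L hL hβ Finset.univ (Sum.elim (leg k) (leg' l))).const_mul (cA k * cB l)]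
  refine Finset.sum_congr rfl fun k _ => ?_
  rw [integral_finsetSum _ fun l _ =>
    (integrable_prodCoord_mul_exp_colourForm L hL hβ Finset.univ (Sum.elim (leg k) (leg' l))).const_mul (cA k * cB l)]
  refine Finset.sum_congr rfl fun l _ => ?_
  rw [integral_const_mul]

/-- Linearity (one factor): `∫ (Σ_k c_k M_k) e^{−βQ} = Σ_k c_k ∫ M_k e^{−βQ}`. -/
theorem integral_sumProd (L : Matrix I I ℝ) (hL : L.PosDef) {β : ℝ} (hβ : 0 < β)
    {κ : Type*} (A : Finset κ) (cA : κ → ℝ) {m : ℕ} (leg : κ → Fin m → I × Fin 3) :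
    ∫ a : I → EuclideanSpace ℝ (Fin 3), (∑ k ∈ A, cA k * ∏ i, a (leg k i).1 (leg k i).2) *
        Real.exp (-(β * ∑ c : Fin 3, (fun e => a e c) ⬝ᵥ (L *ᵥ fun e => a e c))) =
      ∑ k ∈ A, cA k * ∫ a : I → EuclideanSpace ℝ (Fin 3), (∏ i, a (leg k i).1 (leg k i).2) *
        Real.exp (-(β * ∑ c : Fin 3, (fun e => a e c) ⬝ᵥ (L *ᵥ fun e => a e c))) := by
  have hexp : ∀ a : I → EuclideanSpace ℝ (Fin 3),
      (∑ k ∈ A, cA k * ∏ i, a (leg k i).1 (leg k i).2) * Real.exp (-(β * ∑ c : Fin 3, (fun e => a e c) ⬝ᵥ (L *ᵥ fun e => a e c))) =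
        ∑ k ∈ A, cA k * ((∏ i, a (leg k i).1 (leg k i).2) * Real.exp (-(β * ∑ c : Fin 3, (fun e => a e c) ⬝ᵥ (L *ᵥ fun e => a e c)))) := by
    intro a
    rw [Finset.sum_mul]
    refine Finset.sum_congr rfl fun k _ => ?_
    ring
  simp_rw [hexp]
  rw [integral_finsetSum _ fun k _ => (integrable_prodCoord_mul_exp_colourForm' L hL hβ _).const_mul (cA k)]
  refine Finset.sum_congr rfl fun k _ => ?_
  rw [integral_const_mul]

/-! ## §3 The STEP-2 observables as polynomials of bounded total degree in `♭a` -/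

omit [DecidableEq I] in
/-- A colour leg `u ⬝ᵥ a^c` is the evaluation at `♭a` of the linear polynomial `Σ_e u_e·X_{(e,c)}` (total degree ≤ 1). -/
theorem exists_mvPolynomial_leg (u : I → ℝ) (c : Fin 3) :
    ∃ Φ : MvPolynomial (I × Fin 3) ℝ, Φ.totalDegree ≤ 1 ∧
      ∀ a : I → EuclideanSpace ℝ (Fin 3), MvPolynomial.eval (flatten I a) Φ = u ⬝ᵥ fun e => a e c := by
  refine ⟨∑ e : I, MvPolynomial.C (u e) * MvPolynomial.X (e, c), ?_, fun a => ?_⟩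
  · refine MvPolynomial.totalDegree_finsetSum_le fun e _ => (MvPolynomial.totalDegree_mul _ _).trans ?_
    rw [MvPolynomial.totalDegree_C, MvPolynomial.totalDegree_X, zero_add]
  · simp only [MvPolynomial.eval_sum, MvPolynomial.eval_mul, MvPolynomial.eval_C, MvPolynomial.eval_X, flatten_apply, dotProduct]

omit [DecidableEq I] in
/-- ★ The second-order plaquette cost `c_u(a) = Σ_c (u ⬝ᵥ a^c)²` is the evaluation at `♭a` of a polynomial of total degree ≤ 2. -/
theorem exists_mvPolynomial_colourSumSq (u : I → ℝ) :
    ∃ Φ : MvPolynomial (I × Fin 3) ℝ, Φ.totalDegree ≤ 2 ∧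
      ∀ a : I → EuclideanSpace ℝ (Fin 3), MvPolynomial.eval (flatten I a) Φ = ∑ c : Fin 3, (u ⬝ᵥ fun e => a e c) ^ 2 := by
  choose Φ hdeg heval using fun c : Fin 3 => exists_mvPolynomial_leg (I := I) u c
  refine ⟨∑ c : Fin 3, Φ c ^ 2, ?_, fun a => ?_⟩
  · refine MvPolynomial.totalDegree_finsetSum_le fun c _ => (MvPolynomial.totalDegree_pow _ _).trans ?_
    have := hdeg c
    omega
  · simp only [MvPolynomial.eval_sum, MvPolynomial.eval_pow, heval]

omit [DecidableEq I] in
/-- ★ The CENTRED cost `c̃_u = c_u − m` (any constant `m`, e.g. its Gaussian mean) is still the evaluation of a polynomial of total degree ≤ 2. -/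
theorem exists_mvPolynomial_colourSumSq_sub_const (u : I → ℝ) (m : ℝ) :
    ∃ Φ : MvPolynomial (I × Fin 3) ℝ, Φ.totalDegree ≤ 2 ∧
      ∀ a : I → EuclideanSpace ℝ (Fin 3), MvPolynomial.eval (flatten I a) Φ = (∑ c : Fin 3, (u ⬝ᵥ fun e => a e c) ^ 2) - m := by
  obtain ⟨Φ, hdeg, heval⟩ := exists_mvPolynomial_colourSumSq (I := I) u
  refine ⟨Φ - MvPolynomial.C m, ?_, fun a => ?_⟩
  · refine (MvPolynomial.totalDegree_sub _ _).trans ?_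
    rw [MvPolynomial.totalDegree_C]
    exact max_le hdeg (Nat.zero_le _)
  · simp only [map_sub, MvPolynomial.eval_C, heval]

omit [Fintype I] [DecidableEq I] in
/-- ★ Any finite linear combination of `m`-fold products of colour components (e.g. the cubic vertex `V₃`, `m = 3`) is the evaluation at `♭a`
of a polynomial of total degree ≤ `m`. -/
theorem exists_mvPolynomial_sum_prodCoord {κ : Type*} (A : Finset κ) (cA : κ → ℝ) (m : ℕ) (leg : κ → Fin m → I × Fin 3) :
    ∃ Φ : MvPolynomial (I × Fin 3) ℝ, Φ.totalDegree ≤ m ∧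
      ∀ a : I → EuclideanSpace ℝ (Fin 3), MvPolynomial.eval (flatten I a) Φ = ∑ k ∈ A, cA k * ∏ i, a (leg k i).1 (leg k i).2 := by
  refine ⟨∑ k ∈ A, MvPolynomial.C (cA k) * ∏ i : Fin m, MvPolynomial.X (leg k i), ?_, fun a => ?_⟩
  · refine MvPolynomial.totalDegree_finsetSum_le fun k _ => (MvPolynomial.totalDegree_mul _ _).trans ?_
    rw [MvPolynomial.totalDegree_C, zero_add]
    refine (MvPolynomial.totalDegree_finsetProd _ _).trans ?_
    refine (Finset.sum_le_sum fun i _ => (MvPolynomial.totalDegree_X (R := ℝ) (leg k i)).le).trans ?_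
    simp
  · simp only [MvPolynomial.eval_sum, MvPolynomial.eval_mul, MvPolynomial.eval_C, MvPolynomial.eval_prod, MvPolynomial.eval_X]
    rfl

omit [Fintype I] [DecidableEq I] in
/-- The same with a constant subtracted (centring). -/
theorem exists_mvPolynomial_sum_prodCoord_sub_const {κ : Type*} (A : Finset κ) (cA : κ → ℝ) (m : ℕ) (leg : κ → Fin m → I × Fin 3) (m₀ : ℝ) :
    ∃ Φ : MvPolynomial (I × Fin 3) ℝ, Φ.totalDegree ≤ m ∧
      ∀ a : I → EuclideanSpace ℝ (Fin 3), MvPolynomial.eval (flatten I a) Φ = (∑ k ∈ A, cA k * ∏ i, a (leg k i).1 (leg k i).2) - m₀ := by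
  obtain ⟨Φ, hdeg, heval⟩ := exists_mvPolynomial_sum_prodCoord (I := I) A cA m leg
  refine ⟨Φ - MvPolynomial.C m₀, ?_, fun a => ?_⟩
  · refine (MvPolynomial.totalDegree_sub _ _).trans ?_
    rw [MvPolynomial.totalDegree_C]
    exact max_le hdeg (Nat.zero_le _)
  · simp only [map_sub, MvPolynomial.eval_C, heval]

end EdgeChartGaussian

end Summit.QuantumFields.YangMills.Theorems.AllWindowsColdBoxBoxHighLine

end
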